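import Mathlib
import HarnessLib
import Summits.NavierStokesRegularity.NavierStokesRegularity.Theorems.TypeIQuarterGateScarEnvelopeTypeIForcedTsaiStokesletTailObstruction

/-!
# ARM B — DATUM B-2j CORRECTION / B-2m, kernel part (K1a): the EXACTLY `(−1)`-homogeneous SWIRL tail
  `V_e(y) = (y × e)/|y|²` is NOT a zero mode of the linearised Leray profile operator
  (ns-wall-extremal, eng-1 lineage g6, 2026-08-29)

WHAT IS PROVED (theorem-only; explicit fields; standard axioms).  With
`V_e(y) := (‖y‖²)^{−1} • (y × e)` — pure differential rotation about the axis `e` with the Type-I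
rate `|V_e| ~ |y|⁻¹` (the leading term of the `J = 1` swirl sector of DATUM B-2j) — and `x ≠ 0`:
* `swirlTail_homogeneous` : `V_e(t•y) = t⁻¹ • V_e(y)` (`t > 0`), so the Leray drift `½V_e + ½DV_e·y`
  vanishes (p688729);
* `hasFDerivAt_swirlTail` : the derivative as an explicit continuous linear map;
* `laplacian_swirlTail` : `ΔV_e(x) = −2(‖x‖²)^{−2} (x × e)` (local Leibniz rule + radial calculus;
  the linear factor `y ↦ y × e` is harmonic);
* ★ `swirlTail_linearisedResidual` :
  `−ΔV_e(x) + ½V_e(x) + ½DV_e(x)[x] = 2(‖x‖²)^{−2} (x × e)` — NON-ZERO off the axis `ℝe`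
  (`swirlTail_linearisedResidual_eq_zero_iff`): the exactly homogeneous swirl tail is NOT an
  exterior zero mode of the linearised profile equation (contrast the Stokeslet, p691545, and the
  companion-corrected swirl modes of DATUM B-2m, e.g. `(|y|⁻³ + 6|y|⁻⁵)(y × ∇P₂)` for `J = 2`);
* `convect_swirlTail` : `(V_e·∇)V_e(x) = (‖x‖²)^{−2}(⟪e,x⟫ e − ‖e‖² x)` (centripetal acceleration);
* `divergence_swirlTail_eq_zero` : `div V_e = 0` off the origin.

MEANING (HOME/ARM-B/swirltail-eng1g6/B2J-CORRECTION.md §0/§2; ns-wall-crit-1 g4 ruling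
2026-08-29T04:23:48Z (ii)): this is the NARROWED sentence of DATUM B-2j §3 as a theorem — «no
EXACTLY (−1)-homogeneous zero-residual exterior tail in the swirl sector J = 1; residual
`J(J+1)|y|^{−J−3}Φ_J = 2(y×e)/|y|⁴`».  The decaying swirl zero modes that DO exist carry the
`|y|⁻³` companion (B-2m FACT 1).  The registered-currency consequence (vorticity residual of norm
`≥ 4‖e‖/‖y‖⁴`, weight-5 density not integrable) is the sibling module `…ExactSwirlTailObstruction`.
HONEST FRAME: pointwise identities for explicit fields on `ℝ³ ∖ {0}`; nothing about the wall H3,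
crux `ScarEnvelopeTypeI` (stmt-23843, OPEN) or Navier–Stokes regularity (NOT proved).
-/

noncomputable section

set_option linter.dupNamespace false

namespace Summit.NavierStokesRegularity.NavierStokesRegularity.Cruxes.ScarEnvelopeTypeI.ForcedTsai

namespace SwirlTail

open scoped Laplacian RealInnerProductSpace InnerProductSpace
open Literature.Analysis.FluidPDE Literature.Analysis.PDE Set Filter Topology

/-! ## Vector algebra on `ℝ³` used below -/

/-- The vector triple product `(x × e) × e = ⟪e, x⟫ e − ‖e‖² x`. -/
theorem cross_cross_self (x e : E3) : cross (cross x e) e = ⟪e, x⟫ • e - (‖e‖ ^ 2) • x := by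
  have hI : ∀ a b : E3, ⟪a, b⟫ = a 0 * b 0 + a 1 * b 1 + a 2 * b 2 := fun a b => by
    simp [EuclideanSpace.inner_eq_star_dotProduct, dotProduct, Fin.sum_univ_three, mul_comm]
  rw [← real_inner_self_eq_norm_sq, hI, hI]
  ext i
  fin_cases i <;> simp [cross, cross_apply] <;> ring

/-- `⟪x, c • (x × e)⟫ = 0`: the swirl tail is tangent to spheres (radial component zero). -/
theorem inner_self_smul_cross (x e : E3) (c : ℝ) : ⟪x, c • cross x e⟫ = 0 := by
  have hI : ∀ a b : E3, ⟪a, b⟫ = a 0 * b 0 + a 1 * b 1 + a 2 * b 2 := fun a b => by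
    simp [EuclideanSpace.inner_eq_star_dotProduct, dotProduct, Fin.sum_univ_three, mul_comm]
  suffices h : ⟪x, cross x e⟫ = 0 by rw [inner_smul_right, h, mul_zero]
  have h3 : ⟪x, cross x e⟫ = x 0 * (x 1 * e 2 - x 2 * e 1) + x 1 * (x 2 * e 0 - x 0 * e 2)
      + x 2 * (x 0 * e 1 - x 1 * e 0) := by
    rw [hI]; simp [cross, cross_apply]
  rw [h3]; ring

/-- The field `y ↦ y × e` is the continuous linear map `crossCLM.flip e`. -/
theorem cross_const_eq_flip (e : E3) : (fun y : E3 => cross y e) = fun y => (crossCLM.flip e) y := by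
  funext y
  simp

/-- Linearity of `y ↦ y × e` through an orthonormal expansion: `Σᵢ ⟪x, bᵢ⟫ (bᵢ × e) = x × e`. -/
theorem sum_inner_smul_cross {ι : Type*} [Fintype ι] (b : OrthonormalBasis ι ℝ E3) (x e : E3) :
    ∑ i, ⟪x, b i⟫ • cross (b i) e = cross x e := by
  have hx : ∑ i, ⟪x, b i⟫ • b i = x := by
    conv_rhs => rw [← b.sum_repr' x]
    exact Finset.sum_congr rfl fun i _ => by rw [real_inner_comm]
  calc ∑ i, ⟪x, b i⟫ • cross (b i) e = ∑ i, (crossCLM.flip e) (⟪x, b i⟫ • b i) := by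
        refine Finset.sum_congr rfl fun i _ => ?_
        rw [map_smul]; simp
    _ = (crossCLM.flip e) (∑ i, ⟪x, b i⟫ • b i) := by rw [map_sum]
    _ = cross x e := by rw [hx]; simp

/-! ## The exact swirl tail `V_e(y) = (‖y‖²)⁻¹ • (y × e)` -/

/-- **Degree `−1` homogeneity**: `V_e(t•y) = t⁻¹ • V_e(y)` for `t > 0`. -/
theorem swirlTail_homogeneous (e y : E3) {t : ℝ} (ht : 0 < t) :
    (‖t • y‖ ^ 2) ^ (-(1 : ℝ)) • cross (t • y) e = t⁻¹ • ((‖y‖ ^ 2) ^ (-(1 : ℝ)) • cross y e) := by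
  have hn : ‖t • y‖ ^ 2 = t ^ 2 * ‖y‖ ^ 2 := by
    rw [norm_smul, Real.norm_eq_abs, abs_of_pos ht]; ring
  have hc : cross (t • y) e = t • cross y e := by
    rw [← crossCLM_apply, map_smul, smul_apply, crossCLM_apply]
  have h1 : (t ^ 2 * ‖y‖ ^ 2) ^ (-(1 : ℝ)) = (t ^ 2)⁻¹ * (‖y‖ ^ 2) ^ (-(1 : ℝ)) := by
    rw [Real.mul_rpow (by positivity) (by positivity), Real.rpow_neg_one]
  have h2 : (t ^ 2)⁻¹ * t = t⁻¹ := by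
    field_simp
  rw [hn, hc, h1, smul_smul, mul_assoc, mul_comm ((‖y‖ ^ 2) ^ (-(1 : ℝ))) t, ← mul_assoc, h2,
    ← smul_smul]

/-- The derivative of the swirl tail off the origin, as an explicit continuous linear map:
`DV_e(x) = (‖x‖²)⁻¹ (· × e) − 2(‖x‖²)⁻² ⟪x, ·⟫ (x × e)`. -/
theorem hasFDerivAt_swirlTail (e : E3) {x : E3} (hx : x ≠ 0) :
    HasFDerivAt (fun y : E3 => (‖y‖ ^ 2) ^ (-(1 : ℝ)) • cross y e)
      (((‖x‖ ^ 2) ^ (-(1 : ℝ))) • (crossCLM.flip e)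
        + ((2 * (-(1 : ℝ)) * (‖x‖ ^ 2) ^ (-(1 : ℝ) - 1)) • innerSL ℝ x).smulRight (cross x e)) x := by
  have hc : HasFDerivAt (fun y : E3 => cross y e) (crossCLM.flip e) x := by
    rw [cross_const_eq_flip]
    exact (crossCLM.flip e).hasFDerivAt
  exact (hasFDerivAt_norm_sq_rpow (-(1 : ℝ)) hx).smul hc

/-- The swirl tail is differentiable off the origin. -/
theorem differentiableAt_swirlTail (e : E3) {x : E3} (hx : x ≠ 0) :
    DifferentiableAt ℝ (fun y : E3 => (‖y‖ ^ 2) ^ (-(1 : ℝ)) • cross y e) x :=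
  (hasFDerivAt_swirlTail e hx).differentiableAt

/-- The radial factor `(‖y‖²)⁻¹` is `C²` off the origin. -/
theorem contDiffAt_norm_sq_rpow_neg_one {x : E3} (hx : x ≠ 0) :
    ContDiffAt ℝ 2 (fun y : E3 => (‖y‖ ^ 2) ^ (-(1 : ℝ))) x := by
  have hσ : (‖x‖ ^ 2) ≠ 0 := by positivity
  exact ((contDiff_norm_sq ℝ (E := E3)).contDiffAt).rpow_const_of_ne hσ

/-- **Laplacian of the swirl tail**: `ΔV_e(x) = −2(‖x‖²)^{−2} (x × e)` for `x ≠ 0`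
(`Δ(σ⁻¹) = 2σ⁻²` in `ℝ³`, cross term `4·(−σ⁻²)`, `y × e` harmonic). -/
theorem laplacian_swirlTail (e : E3) {x : E3} (hx : x ≠ 0) :
    (Δ (fun y : E3 => (‖y‖ ^ 2) ^ (-(1 : ℝ)) • cross y e)) x
      = (-2 * (‖x‖ ^ 2) ^ (-(2 : ℝ))) • cross x e := by
  have hσ : 0 < ‖x‖ ^ 2 := by positivity
  have hr : ‖x‖ ≠ 0 := norm_ne_zero_iff.mpr hx
  set b := EuclideanSpace.basisFun (Fin 3) ℝ with hb
  have hφ := contDiffAt_norm_sq_rpow_neg_one hx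
  have hg : ContDiffAt ℝ 2 (fun y : E3 => cross y e) x := by
    rw [cross_const_eq_flip]; exact (crossCLM.flip e).contDiff.contDiffAt
  rw [LoewnerNirenberg.laplacian_smul_apply hφ hg b]
  -- `Δ (y × e) = 0`
  have hΔg : (Δ (fun y : E3 => cross y e)) x = 0 := by
    rw [cross_const_eq_flip]; exact laplacian_clm (crossCLM.flip e) x
  -- first derivatives
  have hg1 : HasDerivAt (fun s : ℝ => s ^ (-(1 : ℝ))) (-(1 : ℝ) * (‖x‖ ^ 2) ^ (-(1 : ℝ) - 1))
      (‖x‖ ^ 2) := by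
    simpa using Real.hasDerivAt_rpow_const (x := ‖x‖ ^ 2) (p := -(1 : ℝ)) (Or.inl hσ.ne')
  have hd1 : ∀ i, fderiv ℝ (fun y : E3 => (‖y‖ ^ 2) ^ (-(1 : ℝ))) x (b i)
      = 2 * (-(1 : ℝ) * (‖x‖ ^ 2) ^ (-(1 : ℝ) - 1)) * ⟪x, b i⟫ := fun i =>
    fderiv_comp_norm_sq_apply (g := fun s : ℝ => s ^ (-(1 : ℝ))) hg1 (b i)
  have hdg : ∀ i, fderiv ℝ (fun y : E3 => cross y e) x (b i) = cross (b i) e := fun i => by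
    rw [cross_const_eq_flip, show (fun y : E3 => (crossCLM.flip e) y) = ⇑(crossCLM.flip e) from rfl,
      (crossCLM.flip e).fderiv]
    simp
  have hsum : ∑ i, (fderiv ℝ (fun y : E3 => (‖y‖ ^ 2) ^ (-(1 : ℝ))) x (b i)) •
      fderiv ℝ (fun y : E3 => cross y e) x (b i)
      = (2 * (-(1 : ℝ) * (‖x‖ ^ 2) ^ (-(1 : ℝ) - 1))) • cross x e := by
    calc ∑ i, (fderiv ℝ (fun y : E3 => (‖y‖ ^ 2) ^ (-(1 : ℝ))) x (b i)) •
          fderiv ℝ (fun y : E3 => cross y e) x (b i)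
        = ∑ i, (2 * (-(1 : ℝ) * (‖x‖ ^ 2) ^ (-(1 : ℝ) - 1)) * ⟪x, b i⟫) • cross (b i) e :=
          Finset.sum_congr rfl fun i _ => by rw [hd1, hdg]
      _ = (2 * (-(1 : ℝ) * (‖x‖ ^ 2) ^ (-(1 : ℝ) - 1))) • ∑ i, ⟪x, b i⟫ • cross (b i) e := by
          rw [Finset.smul_sum]
          exact Finset.sum_congr rfl fun i _ => by rw [mul_smul]
      _ = (2 * (-(1 : ℝ) * (‖x‖ ^ 2) ^ (-(1 : ℝ) - 1))) • cross x e := by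
          rw [sum_inner_smul_cross]
  -- the Laplacian of the radial factor (`finrank = 3`)
  have hg2 : HasDerivAt (fun s : ℝ => -(1 : ℝ) * s ^ (-(1 : ℝ) - 1))
      (-(1 : ℝ) * ((-(1 : ℝ) - 1) * (‖x‖ ^ 2) ^ (-(1 : ℝ) - 1 - 1))) (‖x‖ ^ 2) :=
    (Real.hasDerivAt_rpow_const (x := ‖x‖ ^ 2) (p := -(1 : ℝ) - 1) (Or.inl hσ.ne')).const_mul _
  have hΔφ : (Δ (fun y : E3 => (‖y‖ ^ 2) ^ (-(1 : ℝ)))) x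
      = 4 * (-(1 : ℝ) * ((-(1 : ℝ) - 1) * (‖x‖ ^ 2) ^ (-(1 : ℝ) - 1 - 1))) * ‖x‖ ^ 2
        + 2 * (3 : ℕ) * (-(1 : ℝ) * (‖x‖ ^ 2) ^ (-(1 : ℝ) - 1)) := by
    have key := laplacian_comp_norm_sq (E := E3) (g := fun s : ℝ => s ^ (-(1 : ℝ)))
      (g₁ := fun s : ℝ => -(1 : ℝ) * s ^ (-(1 : ℝ) - 1)) isOpen_Ioi
      (fun s hs => by
        simpa using Real.hasDerivAt_rpow_const (x := s) (p := -(1 : ℝ)) (Or.inl (ne_of_gt hs)))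
      (z := x) hσ hg2
    rw [key, finrank_euclideanSpace_fin]
  rw [hsum, hΔφ, hΔg, smul_zero, add_zero, smul_smul, ← add_smul]
  have e2 : (‖x‖ ^ 2) ^ (-(1 : ℝ) - 1) = (‖x‖⁻¹) ^ 4 := norm_sq_rpow_eq_inv_pow hx (by norm_num)
  have e3 : (‖x‖ ^ 2) ^ (-(1 : ℝ) - 1 - 1) = (‖x‖⁻¹) ^ 6 := norm_sq_rpow_eq_inv_pow hx (by norm_num)
  have e4 : (‖x‖ ^ 2) ^ (-(2 : ℝ)) = (‖x‖⁻¹) ^ 4 := norm_sq_rpow_eq_inv_pow hx (by norm_num)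
  rw [e2, e3, e4]
  congr 1
  push_cast
  field_simp
  ring

/-- ★ **The exactly homogeneous swirl tail is NOT a zero mode of the linearised Leray profile
operator**: for `x ≠ 0`,
`−ΔV_e(x) + ½V_e(x) + ½DV_e(x)[x] = 2(‖x‖²)^{−2} (x × e)`
(the Leray drift vanishes by homogeneity, the Laplacian does not: `J(J+1)|y|^{−J−3}Φ_J` with
`J = 1`).  DATUM B-2j §3 as narrowed by ns-wall-crit-1 (ii). -/
theorem swirlTail_linearisedResidual (e : E3) {x : E3} (hx : x ≠ 0) :
    -((Δ (fun y : E3 => (‖y‖ ^ 2) ^ (-(1 : ℝ)) • cross y e)) x)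
      + (1 / 2 : ℝ) • ((‖x‖ ^ 2) ^ (-(1 : ℝ)) • cross x e)
      + (1 / 2 : ℝ) • fderiv ℝ (fun y : E3 => (‖y‖ ^ 2) ^ (-(1 : ℝ)) • cross y e) x x
      = (2 * (‖x‖ ^ 2) ^ (-(2 : ℝ))) • cross x e := by
  have hhom : ∀ t : ℝ, 0 < t →
      (fun y : E3 => (‖y‖ ^ 2) ^ (-(1 : ℝ)) • cross y e) (t • x)
        = t⁻¹ • (fun y : E3 => (‖y‖ ^ 2) ^ (-(1 : ℝ)) • cross y e) x :=
    fun t ht => swirlTail_homogeneous e x ht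
  have hdrift := leray_drift_eq_zero_of_homogeneous_neg_one hhom (differentiableAt_swirlTail e hx)
  rw [add_assoc, hdrift, add_zero, laplacian_swirlTail e hx, ← neg_smul]
  congr 1
  ring

/-- The linearised residual of the swirl tail vanishes exactly on the axis `ℝe` (off the origin). -/
theorem swirlTail_linearisedResidual_eq_zero_iff (e : E3) {x : E3} (hx : x ≠ 0) :
    (2 * (‖x‖ ^ 2) ^ (-(2 : ℝ))) • cross x e = 0 ↔ cross x e = 0 := by
  have hσ : 0 < (‖x‖ ^ 2) ^ (-(2 : ℝ)) := Real.rpow_pos_of_pos (by positivity) _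
  rw [smul_eq_zero]
  constructor
  · rintro (h | h)
    · exfalso; linarith
    · exact h
  · exact fun h => Or.inr h

/-- **Self-advection of the swirl tail** (centripetal acceleration of the differential rotation):
`(V_e·∇)V_e(x) = (‖x‖²)^{−2}(⟪e,x⟫ e − ‖e‖² x)` for `x ≠ 0`. -/
theorem convect_swirlTail (e : E3) {x : E3} (hx : x ≠ 0) :
    convect (fun y : E3 => (‖y‖ ^ 2) ^ (-(1 : ℝ)) • cross y e)
        (fun y : E3 => (‖y‖ ^ 2) ^ (-(1 : ℝ)) • cross y e) x
      = (⟪e, x⟫ * (‖x‖ ^ 2) ^ (-(2 : ℝ))) • e - (‖e‖ ^ 2 * (‖x‖ ^ 2) ^ (-(2 : ℝ))) • x := by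
  have hr : ‖x‖ ≠ 0 := norm_ne_zero_iff.mpr hx
  have e2 : (‖x‖ ^ 2) ^ (-(1 : ℝ)) = (‖x‖⁻¹) ^ 2 := norm_sq_rpow_eq_inv_pow hx (by norm_num)
  have e4 : (‖x‖ ^ 2) ^ (-(2 : ℝ)) = (‖x‖⁻¹) ^ 4 := norm_sq_rpow_eq_inv_pow hx (by norm_num)
  have hx0 : ⟪x, cross x e⟫ = 0 := by simpa only [one_smul] using inner_self_smul_cross x e 1
  rw [convect, (hasFDerivAt_swirlTail e hx).fderiv]
  simp only [add_apply, smul_apply, ContinuousLinearMap.smulRight_apply,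
    ContinuousLinearMap.flip_apply, crossCLM_apply, innerSL_apply_apply, map_smul, smul_eq_mul,
    hx0, mul_zero, zero_smul, add_zero, cross_cross_self, smul_sub, smul_smul,
    e2, e4]
  have h4 : (‖x‖⁻¹) ^ 2 * (‖x‖⁻¹) ^ 2 = (‖x‖⁻¹) ^ 4 := by ring
  rw [← h4]
  congr 1 <;> (congr 1; ring)

/-- **The swirl tail is divergence free** off the origin: `div V_e = 2g′(|x|²)⟪x, x × e⟫ +
(‖x‖²)⁻¹ tr(· × e) = 0`. -/
theorem divergence_swirlTail_eq_zero (e : E3) {x : E3} (hx : x ≠ 0) :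
    VectorCalculus.divergence (fun y : E3 => (‖y‖ ^ 2) ^ (-(1 : ℝ)) • cross y e) x = 0 := by
  set b := EuclideanSpace.basisFun (Fin 3) ℝ with hb
  rw [divergence_eq_sum_inner_fderiv b, (hasFDerivAt_swirlTail e hx).fderiv]
  have hterm : ∀ i, ⟪b i, (((‖x‖ ^ 2) ^ (-(1 : ℝ))) • (crossCLM.flip e)
      + ((2 * (-(1 : ℝ)) * (‖x‖ ^ 2) ^ (-(1 : ℝ) - 1)) • innerSL ℝ x).smulRight (cross x e)) (b i)⟫
      = (‖x‖ ^ 2) ^ (-(1 : ℝ)) * ⟪b i, cross (b i) e⟫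
        + (2 * (-(1 : ℝ)) * (‖x‖ ^ 2) ^ (-(1 : ℝ) - 1)) * (⟪x, b i⟫ * ⟪b i, cross x e⟫) := by
    intro i
    simp only [add_apply, smul_apply, ContinuousLinearMap.smulRight_apply,
      ContinuousLinearMap.flip_apply, crossCLM_apply, innerSL_apply_apply, inner_add_right,
      real_inner_smul_right, smul_eq_mul]
    ring
  have h0 : ∀ v : E3, ⟪v, cross v e⟫ = 0 := fun v => by
    simpa only [one_smul] using inner_self_smul_cross v e 1
  simp_rw [hterm, h0, mul_zero, zero_add, ← Finset.mul_sum, b.sum_inner_mul_inner, h0, mul_zero]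

end SwirlTail

end Summit.NavierStokesRegularity.NavierStokesRegularity.Cruxes.ScarEnvelopeTypeI.ForcedTsai

end
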